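import Literature.NumberTheory.Automorphic.GL2CCuspFormKFinite
import Literature.NumberTheory.Automorphic.CuspidalPeterssonForm
import Literature.NumberTheory.Automorphic.GL2CUnitaryKTypes
import HarnessLib

/-!
# The lowest `K`-type of a clean cohomological cuspidal representation of `GL₂` over an
# imaginary quadratic field

Assembly of the inputs of the lowest-`K`-type theorem `GL2CUnitaryKTypes.exists_isHW_two_mul` for the
six operators `opsW` (`GL2CCuspFormOps`) on the forms `W` of a clean (`W' = ⊥`) cuspidal automorphic
representation datum `π` of `GL₂(𝔸_K)`, `K` imaginary quadratic, whose infinity type has the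
cohomological `a`-exponents of the dual weights `λ_τ^∨`:

* `pet_rhoAt_left`, `opsW_adjoint` — the operators are of unitary type for the Petersson form
  (`CuspidalPeterssonForm.pet_lieDerivW_left` on the trace-zero matrices at the place, whose norm
  exponent vanishes, `normExponent_complexPlaceLie`; `GL2CArchOps.adjoint_of_skew`);
* `casL_opsW_nat`, `casL_eq_casR_or` — the Casimir scalars `½ d(d+2)` with the natural number
  `d = λ_{σ₀,0} − λ_{σ₀,1}` (dominance), and `d_{σ̄₀} = d_{σ₀}` unless `W` is killed
  (`eq_zero_of_casimir_ne'`);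
* `exists_lowestKType_of_noinv` — granted that no non-zero form is killed by all six operators, `W ∋ w ≠ 0`
  with `E_k w = 0`, `H_k w = (2d + 2) w`: the vector carrying the Eichler–Shimura–Harder class.
[cite: Harder1987, §3.1 (3.1.3)–(3.1.5)]

Theorems only; no named fact.
-/

noncomputable section

-- Mathlib idiom (Mathlib/Algebra/Lie/OfAssociative.lean), as in `GL2CCuspFormOps`.
attribute [local instance 100] LieRing.ofAssociativeRing

open scoped Matrix ComplexConjugate Classical
open Complex NumberField NumberField.mixedEmbedding NumberField.InfinitePlace IsDedekindDomain
open _root_.MeasureTheory _root_.MeasureTheory.Measure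

namespace Literature.NumberTheory.Automorphic

namespace GL2CCuspForm

open AutomorphicRepData GL2CKType GLnComplexCasimir ImaginaryQuadratic
  Literature.NumberTheory.DiophantineGeometry Literature.Barriers.Langlands

variable {K : Type} [Field K] [NumberField K] [IsTotallyComplex K]
  {hcpt : isCompact_glFiniteIntegralLevel 2 K} (π : AutomorphicRepData (AutomorphyDatum.gl 2 K hcpt))

/-! ### Unitarity of the six operators for the Petersson form -/

/-- **The trace-zero matrices at the place act skew-adjointly for the Petersson form**:
`⟪Y x, y⟫ = -⟪x, Y y⟫` for `tr Y = 0` (their norm exponent `2 re tr Y` vanishes).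
[cite: Harder1987, §3.1] [cite: Borel1997, 11.12 (2)] -/
theorem pet_rhoAt_left (h : π.W' = ⊥)
    {ρ𝔤 : (AutomorphyDatum.gl 2 K hcpt).arch.lie →ₗ⁅ℝ⁆ Module.End ℂ π.Quot} (hρ : π.HasLieAction ρ𝔤)
    (T : UnitaryTwist π) (μ : Measure (AdelicGroupData.gl 2 K).automorphicQuotient)
    [(AdelicGroupData.gl 2 K).IsAutomorphicMeasure μ]
    (Y : Matrix (Fin 2) (Fin 2) ℂ) (hY : Y.trace = 0) (x y : π.W) :
    T.pet μ (rhoAt (π.lieOnW h ρ𝔤) (complexPlace K) Y x) y =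
      -T.pet μ x (rhoAt (π.lieOnW h ρ𝔤) (complexPlace K) Y y) := by
  rw [rhoAt_apply, lieOnW_eq_lieDerivW π h hρ, lieOnW_eq_lieDerivW π h hρ]
  refine T.pet_lieDerivW_left μ _ ?_ x y
  change ((∑ w', (complexPlaceLie 2 (complexPlace K) Y).trace.1 w') +
    ∑ w', 2 * ((complexPlaceLie 2 (complexPlace K) Y).trace.2 w').re) = 0
  rw [normExponent_complexPlaceLie, hY, Complex.zero_re, mul_zero]

/-- **The six operators on `W` are of unitary type for the Petersson form**:
`⟪L(E) x, y⟫ = -⟪x, R(E) y⟫` and the same for `F`, `H`. [cite: Harder1987, §3.1] -/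
theorem opsW_adjoint (h : π.W' = ⊥)
    {ρ𝔤 : (AutomorphyDatum.gl 2 K hcpt).arch.lie →ₗ⁅ℝ⁆ Module.End ℂ π.Quot} (hρ : π.HasLieAction ρ𝔤)
    (T : UnitaryTwist π) (μ : Measure (AdelicGroupData.gl 2 K).automorphicQuotient)
    [(AdelicGroupData.gl 2 K).IsAutomorphicMeasure μ] :
    (∀ x y, T.pet μ ((opsW π h ρ𝔤).LE x) y = -T.pet μ x ((opsW π h ρ𝔤).RE y)) ∧
    (∀ x y, T.pet μ ((opsW π h ρ𝔤).LF x) y = -T.pet μ x ((opsW π h ρ𝔤).RF y)) ∧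
    (∀ x y, T.pet μ ((opsW π h ρ𝔤).LH x) y = -T.pet μ x ((opsW π h ρ𝔤).RH y)) :=
  adjoint_of_skew (rhoAt (π.lieOnW h ρ𝔤) (complexPlace K)) (T.isPosForm_pet μ)
    fun Y hY x y => pet_rhoAt_left π h hρ T μ Y hY x y

/-! ### The Casimir scalars with natural `d` -/

/-- The non-negative integer `d_τ = λ_{τ,0} − λ_{τ,1}` of a dominant weight of `GL₂`. [folklore] -/
theorem natCast_toNat_sub {wt : Fin 2 → ℤ} (hdom : Weight.IsDominant wt) :
    (((wt 0 - wt 1).toNat : ℕ) : ℤ) = wt 0 - wt 1 :=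
  Int.toNat_of_nonneg (sub_nonneg.2 (hdom (Fin.zero_le 1)))

/-- **The Casimir scalars of `W` as `½ d(d+2)` with natural `d`.** [cite: Harder1987, §3.1] -/
theorem casL_casR_opsW_nat (h : π.W' = ⊥) {lam : (K →+* ℂ) → Fin 2 → ℤ} {T : InfinityType K 2}
    {ρ𝔤 : (AutomorphyDatum.gl 2 K hcpt).arch.lie →ₗ⁅ℝ⁆ Module.End ℂ π.Quot}
    (hχ : Literature.NumberTheory.Automorphic.HasArchParameter
      (ρ𝔤.comp (LieSubalgebra.topEquiv :
        (⊤ : LieSubalgebra ℝ (Matrix (Fin 2) (Fin 2) (mixedSpace K))) ≃ₗ⁅ℝ⁆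
          Matrix (Fin 2) (Fin 2) (mixedSpace K)).symm.toLieHom) fun σ => (T σ).map ArchWeight.a)
    (hTa : ∀ τ : K →+* ℂ, (T τ).map ArchWeight.a =
      (cohomologicalInfinityType 2 K (Weight.dual (lam τ)) τ).map ArchWeight.a)
    (hdom : ∀ τ, Weight.IsDominant (lam τ)) :
    (∀ v, (opsW π h ρ𝔤).casL v =
      ((2 : ℂ)⁻¹ * (((lam σ₀ 0 - lam σ₀ 1).toNat : ℂ) * (((lam σ₀ 0 - lam σ₀ 1).toNat : ℂ) + 2))) • v) ∧
    (∀ v, (opsW π h ρ𝔤).casR v =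
      ((2 : ℂ)⁻¹ * (((lam (ComplexEmbedding.conjugate σ₀) 0 - lam (ComplexEmbedding.conjugate σ₀) 1).toNat : ℂ) *
        (((lam (ComplexEmbedding.conjugate σ₀) 0 - lam (ComplexEmbedding.conjugate σ₀) 1).toNat : ℂ) + 2))) • v) := by
  obtain ⟨hL, hR⟩ := casL_casR_opsW π h hχ hTa
  have e1 : (((lam σ₀ 0 - lam σ₀ 1 : ℤ)) : ℂ) = (((lam σ₀ 0 - lam σ₀ 1).toNat : ℕ) : ℂ) := by
    rw [← Int.cast_natCast, natCast_toNat_sub (hdom σ₀)]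
  have e2 : (((lam (ComplexEmbedding.conjugate σ₀) 0 - lam (ComplexEmbedding.conjugate σ₀) 1 : ℤ)) : ℂ) =
      (((lam (ComplexEmbedding.conjugate σ₀) 0 - lam (ComplexEmbedding.conjugate σ₀) 1).toNat : ℕ) : ℂ) := by
    rw [← Int.cast_natCast, natCast_toNat_sub (hdom (ComplexEmbedding.conjugate σ₀))]
  refine ⟨fun v => ?_, fun v => ?_⟩
  · rw [hL v, e1]
  · rw [hR v, e2]

/-- `½ d(d+2) = ((d+1)² − 1)/2`, the normalisation of `GL2CUnitaryKTypes`. [folklore] -/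
theorem half_mul_eq (d : ℕ) :
    ((2 : ℂ)⁻¹ * ((d : ℂ) * ((d : ℂ) + 2))) = (((((d + 1 : ℕ) : ℝ) ^ 2 - 1) / 2 : ℝ) : ℂ) := by
  push_cast; ring

/-- `½ d(d+2)` as a real scalar. [folklore] -/
theorem half_mul_eq_ofReal (d : ℕ) :
    ((2 : ℂ)⁻¹ * ((d : ℂ) * ((d : ℂ) + 2))) = (((d : ℝ) * ((d : ℝ) + 2) / 2 : ℝ) : ℂ) := by
  push_cast; ring

/-- `d ↦ d(d+2)` is injective on `ℕ`. [folklore] -/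
theorem eq_of_mul_add_two_eq {d d' : ℕ} (hdd : (d : ℝ) * ((d : ℝ) + 2) / 2 = (d' : ℝ) * ((d' : ℝ) + 2) / 2) :
    d = d' := by
  have h1 : ((d : ℝ) + 1) ^ 2 = ((d' : ℝ) + 1) ^ 2 := by linarith
  have h2 : (d : ℝ) + 1 = (d' : ℝ) + 1 := by
    have ha : (0 : ℝ) ≤ (d : ℝ) + 1 := by positivity
    have hb : (0 : ℝ) ≤ (d' : ℝ) + 1 := by positivity
    exact (pow_left_inj₀ ha hb two_ne_zero).1 h1
  exact_mod_cast (by linarith : (d : ℝ) = d')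

/-! ### Forms killed by the six operators -/

/-- **A form killed by the six operators is killed by the Lie derivatives along `φ_{w₀}(𝔰𝔩₂(ℂ))`**
(the hypothesis of `GL2ArchUnipotent.eq_zero_of_lieDeriv_placeLie_eq_zero`). [cite: Knapp2002, §VI.1] -/
theorem lieDeriv_placeLie_eq_zero_of_killed (h : π.W' = ⊥)
    {ρ𝔤 : (AutomorphyDatum.gl 2 K hcpt).arch.lie →ₗ⁅ℝ⁆ Module.End ℂ π.Quot} (hρ : π.HasLieAction ρ𝔤)
    {v : π.W} (h1 : (opsW π h ρ𝔤).LE v = 0) (h2 : (opsW π h ρ𝔤).LF v = 0) (h3 : (opsW π h ρ𝔤).LH v = 0)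
    (h4 : (opsW π h ρ𝔤).RE v = 0) (h5 : (opsW π h ρ𝔤).RF v = 0) (h6 : (opsW π h ρ𝔤).RH v = 0)
    {Y : Matrix (Fin 2) (Fin 2) ℂ} (hY : Y.trace = 0) :
    lieDeriv (AutomorphyDatum.gl 2 K hcpt).ofArch (ComplexPlace.placeLie 2 (complexPlace K) Y)
      (v : (AdelicGroupData.gl 2 K).Adelic → ℂ) = 0 := by
  have hv := rho_apply_eq_zero_of_killed (rhoAt (π.lieOnW h ρ𝔤) (complexPlace K)) h1 h2 h3 h4 h5 h6 hY
  have hc := congrArg Subtype.val hv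
  rw [rhoAt_apply, coe_lieOnW π h hρ] at hc
  exact hc

/-! ### The lowest `K`-type -/

omit [IsTotallyComplex K] in
/-- A clean `π` has a non-zero form. [folklore] -/
theorem exists_ne_zero (h : π.W' = ⊥) : ∃ v : π.W, v ≠ 0 := by
  obtain ⟨v, hvW, hvW'⟩ := SetLike.exists_of_lt π.lt
  refine ⟨⟨v, hvW⟩, fun h0 => hvW' ?_⟩
  rw [h, Submodule.mem_bot]
  exact congrArg Subtype.val h0

/-- **The lowest `K`-type of a clean cohomological cuspidal `π` of `GL₂` over an imaginary quadratic
field.**  Let `π` (`W' = ⊥`, `W ≤ 𝒜₀`) have Lie action `ρ𝔤` with archimedean parameter the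
`a`-exponents of an infinity type `T` which are the cohomological ones of the dual weights `λ_τ^∨`
(`λ_τ` dominant), and assume no non-zero form is killed by all six operators.  Then, with
`d = λ_{σ₀,0} − λ_{σ₀,1}`: both Casimir scalars are `½ d(d+2)` (so `d_{σ̄₀} = d_{σ₀}`), and `W`
contains a non-zero `𝔨`-highest-weight vector of weight `2d + 2`.
[cite: Harder1987, §3.1 (3.1.3)–(3.1.5)] -/
theorem exists_lowestKType_of_noinv (h : π.W' = ⊥)
    {ρ𝔤 : (AutomorphyDatum.gl 2 K hcpt).arch.lie →ₗ⁅ℝ⁆ Module.End ℂ π.Quot} (hρ : π.HasLieAction ρ𝔤)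
    {lam : (K →+* ℂ) → Fin 2 → ℤ} {T : InfinityType K 2}
    (hχ : Literature.NumberTheory.Automorphic.HasArchParameter
      (ρ𝔤.comp (LieSubalgebra.topEquiv :
        (⊤ : LieSubalgebra ℝ (Matrix (Fin 2) (Fin 2) (mixedSpace K))) ≃ₗ⁅ℝ⁆
          Matrix (Fin 2) (Fin 2) (mixedSpace K)).symm.toLieHom) fun σ => (T σ).map ArchWeight.a)
    (hTa : ∀ τ : K →+* ℂ, (T τ).map ArchWeight.a =
      (cohomologicalInfinityType 2 K (Weight.dual (lam τ)) τ).map ArchWeight.a)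
    (hdom : ∀ τ, Weight.IsDominant (lam τ))
    (Tw : UnitaryTwist π) (μ : Measure (AdelicGroupData.gl 2 K).automorphicQuotient)
    [(AdelicGroupData.gl 2 K).IsAutomorphicMeasure μ]
    (hnoinv : ∀ v : π.W, (opsW π h ρ𝔤).LE v = 0 → (opsW π h ρ𝔤).LF v = 0 → (opsW π h ρ𝔤).LH v = 0 →
      (opsW π h ρ𝔤).RE v = 0 → (opsW π h ρ𝔤).RF v = 0 → (opsW π h ρ𝔤).RH v = 0 → v = 0) :
    (∀ v, (opsW π h ρ𝔤).casL v =
      ((2 : ℂ)⁻¹ * (((lam σ₀ 0 - lam σ₀ 1).toNat : ℂ) * (((lam σ₀ 0 - lam σ₀ 1).toNat : ℂ) + 2))) • v) ∧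
    (∀ v, (opsW π h ρ𝔤).casR v =
      ((2 : ℂ)⁻¹ * (((lam σ₀ 0 - lam σ₀ 1).toNat : ℂ) * (((lam σ₀ 0 - lam σ₀ 1).toNat : ℂ) + 2))) • v) ∧
    ∃ w : π.W, w ≠ 0 ∧ (opsW π h ρ𝔤).IsHW w ((2 * (lam σ₀ 0 - lam σ₀ 1).toNat + 2 : ℕ) : ℂ) := by
  obtain ⟨hL, hR⟩ := casL_casR_opsW_nat π h hχ hTa hdom
  set d := (lam σ₀ 0 - lam σ₀ 1).toNat with hd
  set d' := (lam (ComplexEmbedding.conjugate σ₀) 0 - lam (ComplexEmbedding.conjugate σ₀) 1).toNat with hd'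
  have hO := isLawful_opsW π h ρ𝔤
  have hip := Tw.isPosForm_pet μ
  obtain ⟨hE, hF, hH⟩ := opsW_adjoint π h hρ Tw μ
  have hfin := kFinite_opsW π h hρ
  obtain ⟨v, hv⟩ := exists_ne_zero π h
  -- real forms of the scalars
  have hL' : ∀ x, (opsW π h ρ𝔤).casL x = (((d : ℝ) * ((d : ℝ) + 2) / 2 : ℝ) : ℂ) • x := fun x => by
    rw [hL x, ← half_mul_eq_ofReal]
  have hR' : ∀ x, (opsW π h ρ𝔤).casR x = (((d' : ℝ) * ((d' : ℝ) + 2) / 2 : ℝ) : ℂ) • x := fun x => by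
    rw [hR x, ← half_mul_eq_ofReal]
  -- `d' = d`, for otherwise `W` would be killed
  have hdd : d = d' := by
    by_contra hne
    have hne' : (d : ℝ) * ((d : ℝ) + 2) / 2 ≠ (d' : ℝ) * ((d' : ℝ) + 2) / 2 :=
      fun e => hne (eq_of_mul_add_two_eq e)
    exact hv (Ops.eq_zero_of_casimir_ne' hip hO hE hF hH hne' hL' hR' hfin v)
  have hRd : ∀ x, (opsW π h ρ𝔤).casR x =
      ((2 : ℂ)⁻¹ * ((d : ℂ) * ((d : ℂ) + 2))) • x := fun x => by rw [hR x, ← hdd]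
  refine ⟨hL, hRd, ?_⟩
  -- the lowest `K`-type theorem with `p = d + 1`
  have hcL : ∀ x, (opsW π h ρ𝔤).casL x = (((((d + 1 : ℕ) : ℝ) ^ 2 - 1) / 2 : ℝ) : ℂ) • x := fun x => by
    rw [hL x, half_mul_eq]
  have hcR : ∀ x, (opsW π h ρ𝔤).casR x = (((((d + 1 : ℕ) : ℝ) ^ 2 - 1) / 2 : ℝ) : ℂ) • x := fun x => by
    rw [hRd x, half_mul_eq]
  obtain ⟨w, hw0, hw⟩ := Ops.exists_isHW_two_mul hip hO hE hF hH (Nat.le_add_left 1 d) hcL hcR hfin hnoinv hv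
  refine ⟨w, hw0, ?_⟩
  have : 2 * (d + 1) = 2 * d + 2 := by ring
  rwa [this] at hw

end GL2CCuspForm

end Literature.NumberTheory.Automorphic

end
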